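import Summits.AtomisticToContinuum.Crystallization.Theses.ChessboardParticlePlanes

/-!
# Crux `ChessboardParticlePlanes.LjPlaneChessboard` (stmt-AtomisticToContinuum-6709), line `Sketch`,
# stub `planarLattice` — the horizontal period lattice as a planar `ZLattice`

Two horizontal vectors `a, b ∈ ℝ³` (`a₂ = b₂ = 0`) that are `ℝ`-linearly independent project,
under `(x₀, x₁, x₂) ↦ (x₀, x₁)`, to two `ℝ`-linearly independent vectors `a', b'` of `ℝ²`; the
group `ℤa' ⊕ ℤb'` is then the `ℤ`-span of an `ℝ`-basis of `ℝ²`, hence a discrete subgroup of full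
rank (`ZSpan`), and its elements are exactly the vectors `k a' + l b'`, `k, l ∈ ℤ`. [folklore]

PROOF.  A relation `s a' + t b' = 0` in `ℝ²` gives `s a + t b = 0` in `ℝ³` coordinatewise (the
third coordinates vanish), so `s = t = 0`.  Two independent vectors of the `2`-dimensional space
`ℝ²` form a basis `β` (`basisOfLinearIndependentOfCardEqFinrank`), and Mathlib equips
`span_ℤ (range β)` with `DiscreteTopology` and `IsZLattice ℝ` instances; membership is
`Submodule.mem_span_range_iff_exists_fun` summed over `Fin 2`.
-/

noncomputable section

namespace Summit.AtomisticToContinuum.Crystallization.Theorems.ChessboardParticlePlanesLjPlaneChessboard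

open Literature.MathematicalPhysics.StatisticalMechanics

/-- The horizontal projections `(a₀, a₁), (b₀, b₁) ∈ ℝ²` of two `ℝ`-linearly independent
horizontal vectors `a, b ∈ ℝ³` (`a₂ = b₂ = 0`) are `ℝ`-linearly independent: a relation
`s a' + t b' = 0` lifts coordinatewise to `s a + t b = 0`. [folklore] -/
theorem planarLattice_linearIndependent {a b : EuclideanSpace ℝ (Fin 3)} (ha : a 2 = 0)
    (hb : b 2 = 0) (hab : LinearIndependent ℝ ![a, b]) :
    LinearIndependent ℝ ![!₂[a 0, a 1], !₂[b 0, b 1]] := by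
  rw [LinearIndependent.pair_iff] at hab ⊢
  intro s t hst
  refine hab s t ?_
  have h0 := congrArg (fun v : EuclideanSpace ℝ (Fin 2) => v 0) hst
  have h1 := congrArg (fun v : EuclideanSpace ℝ (Fin 2) => v 1) hst
  simp only [PiLp.add_apply, PiLp.smul_apply, PiLp.zero_apply, smul_eq_mul] at h0 h1
  ext i
  fin_cases i
  · simpa using h0
  · simpa using h1
  · simp [ha, hb]

/-- **Stub — the horizontal period lattice as a planar `ZLattice`.**  For two `ℝ`-linearly
independent horizontal vectors `a, b ∈ ℝ³` (`a₂ = b₂ = 0`) there is a discrete full-rank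
`ℤ`-submodule `L` of `ℝ²` whose elements are exactly the vectors `k (a₀, a₁) + l (b₀, b₁)`,
`k, l ∈ ℤ`: `L` is the `ℤ`-span of the basis `((a₀, a₁), (b₀, b₁))` of `ℝ²`
(`planarLattice_linearIndependent`, `basisOfLinearIndependentOfCardEqFinrank`), a `ZSpan`.
[folklore] -/
theorem planarLattice :
    ∀ (a b : EuclideanSpace ℝ (Fin 3)), a 2 = 0 → b 2 = 0 → LinearIndependent ℝ ![a, b] →
      ∃ L : Submodule ℤ (EuclideanSpace ℝ (Fin 2)), ∃ _ : DiscreteTopology L, IsZLattice ℝ L ∧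
        ∀ v : EuclideanSpace ℝ (Fin 2),
          v ∈ L ↔ ∃ k l : ℤ, v = (k : ℝ) • !₂[a 0, a 1] + (l : ℝ) • !₂[b 0, b 1] := by
  intro a b ha hb hab
  -- the basis `β = (a', b')` of `ℝ²`
  obtain ⟨β, hβ⟩ : ∃ β : Module.Basis (Fin 2) ℝ (EuclideanSpace ℝ (Fin 2)),
      ⇑β = ![!₂[a 0, a 1], !₂[b 0, b 1]] :=
    ⟨basisOfLinearIndependentOfCardEqFinrank (planarLattice_linearIndependent ha hb hab)
      (by simp), coe_basisOfLinearIndependentOfCardEqFinrank _ _⟩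
  refine ⟨Submodule.span ℤ (Set.range β), inferInstance, inferInstance, fun v => ?_⟩
  rw [hβ, Submodule.mem_span_range_iff_exists_fun]
  constructor
  · rintro ⟨n, rfl⟩
    refine ⟨n 0, n 1, ?_⟩
    rw [Fin.sum_univ_two]
    simp only [Matrix.cons_val_zero, Matrix.cons_val_one, Int.cast_smul_eq_zsmul]
  · rintro ⟨k, l, rfl⟩
    refine ⟨![k, l], ?_⟩
    rw [Fin.sum_univ_two]
    simp only [Matrix.cons_val_zero, Matrix.cons_val_one, Int.cast_smul_eq_zsmul]

end Summit.AtomisticToContinuum.Crystallization.Theorems.ChessboardParticlePlanesLjPlaneChessboard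

end
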